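import Literature.AnabelianGeometry.EtaleTheta.TemperedFrobenioidOfGenDiagonalBase
import HarnessLib

/-!
# [EtTh] Def. 3.6 (ii): the higher-rank engine along PATTERN diagonal base data WITH A RAMIFIED UNIFORMISER (class (b))

S. Mochizuki, *The étale theta function …*, Publ. RIMS **45** (2009) [MochizukiEtTh2009], Def. 3.1 (i) p.70, Def. 3.3 (iii) p.73, Def. 3.6
(i)(ii) p.76–77 [cite: MochizukiEtTh2009, Def 3.6 p.77]; [FrdI] Def. 1.1, Def. 2.4 (i) p.47, Prop. 5.3, Thm. 5.2 (ii).
abc-iut cell, layer L2 [EtTh]; seat abc-iut-L2-t3 (gen 7); engine for FILE 4 of the 2c plan (tf over the ε-free (β) `Ÿ`-tower `towerC₃sf`).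
ADDITIVE variant of this seat's `TemperedFrobenioidOfGenDiagonalBase.lean` (p480926; imported, zero edit).  WHY: `GenDiagonalBase.exists_div₀_eq`
asks at EVERY connected covering `A` for a constant family with divisor EXACTLY `[d_A]`; in «GRP₃′» the Kummer class of `ϖ̈` ACTS
(`K_κ (ζ, ϖ̈_l) = (ζ^{κ_ϖ}, ϖ̈_l)`), so on `A = Compat/H` with a point-stabiliser element of `κ_ϖ ≢ 0 (mod N_l)` the least `ϖ̈`-exponent of
an equivariant constant family is the order `e_A > 1` of that action (e.g. `H = closureC l · ⟨natElt (l−2)⟩`, `e_A = l(l+1)`) — print's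
ramification of the covering's constant field over the diagonal.  THIS FILE: `TemperedFrobenioid.PowDiagonalBase dm D` = `GenDiagonalBase`
with the clause WEAKENED to `exists_div₀_eq_pow : ∃ b ∈ F₀(A), ∃ k ≥ 1, div₀ b = [d_A]^k` (`GenDiagonalBase.toPow`: `k = 1`); the engine
re-run verbatim except at the two uses of the clause — `of_mem_cnstR_of_mem_diagImage` (the `ℝ`-span is root-closed: take the `n·k`-th
root) and Def. 3.6 (ii)(b) (`exists_FΛ_div_ne`: `div(ϖ_A) = ι(d_A^k)/1 ≠ 1`, `toRealification_d_pow_ne_one`);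
**`TemperedFrobenioid.ofPowDiagonalBase hpf P hD hD' hFSM R S`** with every Def. 3.6 (ii) clause PROVED, `_bsFld_carrier`, `_isPerfect`,
`isFrobenioid_ofPowDiagonalBase`.  No Prop-valued fact, no instance, no notation, no sorry.  HONEST FRAMING: construction over interface
records; nothing here bears on [IUTchIII] Cor. 3.12; typed ≠ proved.
-/
noncomputable section

namespace Literature.AnabelianGeometry.EtaleTheta

open CategoryTheory Opposite Function Literature.AlgebraicGeometry.Frobenioids

universe u₀ v₀ u v

namespace TemperedFrobenioid


/-- **Pattern diagonal base data with a ramified uniformiser**: as `GenDiagonalBase` (functor `F`, ℕ-valued coordinates `κ_i` with a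
distinguished `i₀`, diagonal `d_A` with `κ_{i₀}(d_A) = 1` and the pattern-form `eq_pow_of_κ_eq`, constants with divisors in `⟨[d_A]⟩`,
injective / divisibility-reflecting pull-backs) EXCEPT that only some positive power `[d_A]^k` is required to be the divisor of a constant.
[cite: MochizukiEtTh2009, Def 3.6 p.77] -/
structure PowDiagonalBase {D₀ : Type u₀} [Category.{v₀} D₀] (dm : DivisorMonoids.{u₀, v₀, 0} D₀)
    (D : Type u) [Category.{v} D] : Type (max u₀ v₀ u v 1) where
  /-- the base functor `D → D₀` -/
  F : D ⥤ D₀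
  /-- the index set of the coordinates of `Φ₀(F A)` -/
  I : D → Type
  /-- a distinguished coordinate index (a component of the special fibre) -/
  i₀ : ∀ A : D, I A
  /-- the coordinates `Φ₀(F A) → ℤ_{≥0}` -/
  κ : ∀ A : D, I A → ((dm.Φ₀.obj (op (F.obj A)) : Type) →* Multiplicative ℕ)
  /-- the diagonal `d_A ∈ Φ₀(F A)` (the reduced special fibre) -/
  d : ∀ A : D, (dm.Φ₀.obj (op (F.obj A)) : Type)
  /-- the distinguished coordinate of the diagonal is `1` -/
  κ_d₀ : ∀ A : D, κ A (i₀ A) (d A) = Multiplicative.ofAdd 1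
  /-- an element all of whose coordinates are those of `d_A^c` is `d_A^c` -/
  eq_pow_of_κ_eq : ∀ (A : D) (m : (dm.Φ₀.obj (op (F.obj A)) : Type)) (c : ℕ),
    (∀ i : I A, κ A i m = κ A i (d A) ^ c) → m = d A ^ c
  /-- the divisor of every constant function is a power of `[d_A]` -/
  div₀_mem_zpowers : ∀ (A : D) (b : (dm.B₀.obj (op (F.obj A)) : Type)), b ∈ dm.F₀ (op (F.obj A)) →
    dm.div₀ _ b ∈ Subgroup.zpowers (Algebra.GrothendieckGroup.of (d A))
  /-- some positive power `[d_A]^k` is the divisor of a constant function (a uniformiser `ϖ_A` of the covering's constant field,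
  `k = e_A` its ramification index over the diagonal) -/
  exists_div₀_eq_pow : ∀ A : D, ∃ b ∈ dm.F₀ (op (F.obj A)), ∃ k : ℕ, 0 < k ∧ dm.div₀ _ b = Algebra.GrothendieckGroup.of (d A) ^ k
  /-- pull-backs of `Φ₀` along `F`-images are injective -/
  hΦinj : ∀ {A B : D} (f : A ⟶ B), Injective (dm.Φ₀.map (F.map f).op).hom
  /-- pull-backs of `Φ₀` along `F`-images reflect divisibility -/
  hΦrefl : ∀ {A B : D} (f : A ⟶ B) (a b : dm.Φ₀.obj (op (F.obj B))),
    (dm.Φ₀.map (F.map f).op).hom a ∣ (dm.Φ₀.map (F.map f).op).hom b → a ∣ b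

/-- **Pattern data (a constant with divisor EXACTLY `[d_A]`) are power-pattern data** (`k = 1`). [cite: MochizukiEtTh2009, Def 3.6 p.77] -/
def GenDiagonalBase.toPow {D₀ : Type u₀} [Category.{v₀} D₀] {dm : DivisorMonoids.{u₀, v₀, 0} D₀} {D : Type u} [Category.{v} D]
    (P : GenDiagonalBase dm D) : PowDiagonalBase dm D where
  F := P.F
  I := P.I
  i₀ := P.i₀
  κ := P.κ
  d := P.d
  κ_d₀ := P.κ_d₀
  eq_pow_of_κ_eq := P.eq_pow_of_κ_eq
  div₀_mem_zpowers := P.div₀_mem_zpowers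
  exists_div₀_eq_pow A := by
    obtain ⟨b, hb, hbd⟩ := P.exists_div₀_eq A
    exact ⟨b, hb, 1, Nat.one_pos, by rw [pow_one, hbd]⟩
  hΦinj f := P.hΦinj f
  hΦrefl f := P.hΦrefl f

namespace PowDiagonalBase

variable {D₀ : Type u₀} [Category.{v₀} D₀] {dm : DivisorMonoids.{u₀, v₀, 0} D₀}
  (hpf : ∀ Y : D₀ᵒᵖ, IsPerfFactorialCof (dm.Φ₀.obj Y)) {D : Type u} [Category.{v} D]

/-- `d_A ≠ 1` (its coordinates are `1`). [cite: MochizukiEtTh2009, Prop 3.2 p.70] -/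
theorem d_ne_one (P : PowDiagonalBase dm D) (A : D) : P.d A ≠ 1 := fun h => by
  have h2 := P.κ_d₀ A
  rw [h, map_one] at h2
  exact one_ne_zero (ofAdd_eq_one.mp h2.symm)

/-- **An element of `Φ₀(F A)^pf` whose coordinates follow the diagonal pattern is (a root of) a power of the diagonal**:
if `κ_i^pf(a) = (κ_{i₀}^pf(a))^{n_i}` for every `i` (`n_i = κ_i(d_A)`), then `a` lies in the image of `⟨d_A⟩^pf → Φ₀(F A)^pf`.
[cite: MochizukiEtTh2009, Prop 3.2 p.70] -/
theorem mem_mrange_map_powersHom_of_forall_eq (P : PowDiagonalBase dm D) (A : D) (a : Perfection (dm.Φ₀.obj (op (P.F.obj A))))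
    (h : ∀ i : P.I A, Perfection.map (P.κ A i) a =
      Perfection.map (P.κ A (P.i₀ A)) a ^ Multiplicative.toAdd (P.κ A i (P.d A))) :
    a ∈ MonoidHom.mrange (Perfection.map (powersHom (dm.Φ₀.obj (op (P.F.obj A))) (P.d A))) := by
  obtain ⟨⟨m, n⟩, rfl⟩ := Perfection.mk_surjective a
  -- every coordinate of `m` is `n_i` times its `i₀`-th coordinate
  have hcoord : ∀ i : P.I A, P.κ A i m = P.κ A (P.i₀ A) m ^ Multiplicative.toAdd (P.κ A i (P.d A)) := by
    intro i
    have hi := h i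
    simp only [Perfection.map_mk, Perfection.mk_pow] at hi
    obtain ⟨N, hN⟩ := Perfection.mk_eq_mk_iff.mp hi
    have hN' := congrArg Multiplicative.toAdd hN
    simp only [toAdd_pow, smul_eq_mul] at hN'
    apply Multiplicative.toAdd.injective
    rw [toAdd_pow, smul_eq_mul]
    exact Nat.eq_of_mul_eq_mul_left (Nat.mul_pos N.pos n.pos) hN'
  have hm : m = P.d A ^ Multiplicative.toAdd (P.κ A (P.i₀ A) m) :=
    P.eq_pow_of_κ_eq A m _ fun i => by
      rw [hcoord i]
      apply Multiplicative.toAdd.injective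
      rw [toAdd_pow, toAdd_pow, smul_eq_mul, smul_eq_mul, mul_comm]
  refine ⟨Perfection.mk (Multiplicative.ofAdd (Multiplicative.toAdd (P.κ A (P.i₀ A) m))) n, ?_⟩
  rw [Perfection.map_mk, powersHom_apply, toAdd_ofAdd, ← hm]

/-- `⟨d_A⟩^pf → Φ₀(F A)^pf` is injective (read at the coordinate `i₀`). [cite: MochizukiEtTh2009, Prop 3.2 p.70] -/
theorem map_powersHom_injective (P : PowDiagonalBase dm D) (A : D) :
    Injective (Perfection.map (powersHom (dm.Φ₀.obj (op (P.F.obj A))) (P.d A))) := by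
  intro x y hxy
  obtain ⟨⟨c, n⟩, rfl⟩ := Perfection.mk_surjective x
  obtain ⟨⟨c', n'⟩, rfl⟩ := Perfection.mk_surjective y
  simp only [Perfection.map_mk, powersHom_apply] at hxy
  obtain ⟨N, hN⟩ := Perfection.mk_eq_mk_iff.mp hxy
  -- read the relation at the coordinate `i₀`
  have hN' := congrArg (fun m => Multiplicative.toAdd (P.κ A (P.i₀ A) m)) hN
  simp only [← pow_mul, map_pow, P.κ_d₀, toAdd_pow, toAdd_ofAdd, smul_eq_mul, mul_one] at hN'
  change Perfection.mk c n = Perfection.mk c' n'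
  refine Perfection.mk_eq_mk_iff.mpr ⟨N, ?_⟩
  apply Multiplicative.toAdd.injective
  simp only [toAdd_pow, smul_eq_mul]
  -- `hN'` : toAdd c * (N * n') = toAdd c' * (N * n)
  rw [mul_comm, hN', mul_comm]

/-- `d_A^k ≠ 1` for `k ≥ 1` (read at the distinguished coordinate). [cite: MochizukiEtTh2009, Prop 3.2 p.70] -/
theorem d_pow_ne_one (P : PowDiagonalBase dm D) (A : D) {k : ℕ} (hk : 0 < k) : P.d A ^ k ≠ 1 := fun h => by
  have h2 := congrArg (fun m => Multiplicative.toAdd (P.κ A (P.i₀ A) m)) h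
  simp only [map_pow, P.κ_d₀, toAdd_pow, toAdd_ofAdd, smul_eq_mul, mul_one, map_one, toAdd_one] at h2
  exact hk.ne' h2

/-- `ι(d_A^k) ≠ 1` in `Φ₀^ℝ(F A)` for `k ≥ 1`. [cite: MochizukiEtTh2009, Def 3.6 p.77] -/
theorem toRealification_d_pow_ne_one (P : PowDiagonalBase dm D) (A : D) {k : ℕ} (hk : 0 < k) :
    (hpf (op (P.F.obj A))).weak.toRealification (Perfection.of _ (P.d A ^ k)) ≠ 1 := by
  intro h
  have h1 := PfImageWeak.toRealification_injective (hpf (op (P.F.obj A))).weak (h.trans (map_one _).symm)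
  rw [Perfection.of_apply, Perfection.mk_eq_one_iff_of_isSharp (hpf _).weak.isDivisorial.isSharp] at h1
  exact P.d_pow_ne_one A hk h1

/-- `Φ(A) := im(Φ₀(F A)^pf → Φ₀(F A)^rlf)` (weak realification map; print's `Φ`). [cite: MochizukiEtTh2009, Def 3.6 p.76] -/
def pfImage (P : PowDiagonalBase dm D) (A : Dᵒᵖ) : Submonoid ((RealifiedDivisorMonoids.ofRlfZWeak dm hpf).ΦR.obj (op (P.F.obj A.unop))) :=
  MonoidHom.mrange (hpf (op (P.F.obj A.unop))).weak.toRealification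

/-- The diagonal image `ι(⟨d_A⟩^pf) ⊆ Φ(A)`: the classes of the roots `(d_A^c)^{1/n}` — it will be `Φ^{bs-fld}(A)`.
[cite: MochizukiEtTh2009, Def 3.6 p.77] -/
def diagImage (P : PowDiagonalBase dm D) (A : Dᵒᵖ) : Submonoid ((RealifiedDivisorMonoids.ofRlfZWeak dm hpf).ΦR.obj (op (P.F.obj A.unop))) :=
  MonoidHom.mrange ((hpf (op (P.F.obj A.unop))).weak.toRealification.comp
    (Perfection.map (powersHom (dm.Φ₀.obj (op (P.F.obj A.unop))) (P.d A.unop))))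

/-- `ι(⟨d⟩^pf) ⊆ Φ`. [cite: MochizukiEtTh2009, Def 3.6 p.77] -/
theorem diagImage_le_pfImage (P : PowDiagonalBase dm D) (A : Dᵒᵖ) : P.diagImage hpf A ≤ P.pfImage hpf A := by
  rintro _ ⟨a, rfl⟩
  exact ⟨_, rfl⟩

/-- `ι(⟨d⟩^pf)` is monoprime (`≅ (ℤ_{≥0})^pf ≅ ℚ_{≥0}`). [cite: MochizukiEtTh2009, Def 3.6 p.77] -/
theorem isMonoprime_diagImage (P : PowDiagonalBase dm D) (A : Dᵒᵖ) : IsMonoprime ↥(P.diagImage hpf A) := by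
  have hinj : Injective ((hpf (op (P.F.obj A.unop))).weak.toRealification.comp
      (Perfection.map (powersHom (dm.Φ₀.obj (op (P.F.obj A.unop))) (P.d A.unop)))) :=
    (PfImageWeak.toRealification_injective (hpf _).weak).comp (P.map_powersHom_injective A.unop)
  exact IsMonoprime.of_mulEquiv
    (MulEquiv.ofBijective _ ⟨fun _ _ h => hinj (congrArg Subtype.val h), MonoidHom.mrangeRestrict_surjective _⟩)
    (PerfectionPrimes.isMonoprime_perfection isMonoprime_multiplicative_nat)

/-- `ι^gp([d_A]^k) = [ι(d_A)]^k` in `(Φ₀^ℝ)^gp` (THE weak realification data: `ι^gp = gpMap (Φ₀ → Φ₀^rlf)`).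
[cite: MochizukiEtTh2009, Def 3.6 p.76] -/
theorem toRlfGp_of_d_zpow (P : PowDiagonalBase dm D) (A : D) (k : ℤ) :
    ((RealifiedDivisorMonoids.realDataWeak dm hpf).toRlfGp (P.F.obj A) (Algebra.GrothendieckGroup.of (P.d A) ^ k) :
        Algebra.GrothendieckGroup (hpf (op (P.F.obj A))).weak.Rlf) =
      (Algebra.GrothendieckGroup.of ((hpf (op (P.F.obj A))).weak.toRealification (Perfection.of _ (P.d A))) :
        Algebra.GrothendieckGroup (hpf (op (P.F.obj A))).weak.Rlf) ^ k := by
  rw [map_zpow,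
    show ((RealifiedDivisorMonoids.realDataWeak dm hpf).toRlfGp (P.F.obj A) (Algebra.GrothendieckGroup.of (P.d A)) :
        Algebra.GrothendieckGroup (hpf (op (P.F.obj A))).weak.Rlf) =
      (Algebra.GrothendieckGroup.of ((hpf (op (P.F.obj A))).weak.toRealification (Perfection.of _ (P.d A))) :
        Algebra.GrothendieckGroup (hpf (op (P.F.obj A))).weak.Rlf) from MonGp.map_of _ _]
  rfl

/-- **`ι(⟨d⟩^pf) ⊆ ℝ·Φ₀^cnst`**: `[ι((d^c)^{1/n})]^n = [ι(d^c)] = ι^gp([d]^c) ∈ ℝ·Φ₀^cnst` (`[d]` is the divisor of a constant,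
`Φ₀^cnst ⊆ ℝ·Φ₀^cnst`), and `ℝ·Φ₀^cnst` is root-closed. [cite: MochizukiEtTh2009, Def 3.6 p.76] -/
theorem of_mem_cnstR_of_mem_diagImage (P : PowDiagonalBase dm D) (A : Dᵒᵖ) {x : (RealifiedDivisorMonoids.ofRlfZWeak dm hpf).ΦR.obj (op (P.F.obj A.unop))}
    (hx : x ∈ P.diagImage hpf A) :
    Algebra.GrothendieckGroup.of x ∈ (RealifiedDivisorMonoids.ofRlfZWeak dm hpf).cnstR (op (P.F.obj A.unop)) := by
  obtain ⟨a, rfl⟩ := hx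
  obtain ⟨⟨c, n⟩, rfl⟩ := Perfection.mk_surjective a
  have hM := hpf (op (P.F.obj A.unop))
  -- `[ι(d^{ck})] = ι^gp(div₀(b^c)) ∈ ℝ·Φ₀^cnst` since `Φ₀^cnst ⊆ ℝ·Φ₀^cnst` (`div₀ b = [d]^k`, `k ≥ 1`)
  obtain ⟨b, hb, k, hk, hbd⟩ := P.exists_div₀_eq_pow A.unop
  refine (RealifiedDivisorMonoids.ofRlfZWeak dm hpf).cnstR_root _ _ (n * ⟨k, hk⟩) ?_
  have key := (RealifiedDivisorMonoids.ofRlfZWeak dm hpf).cnst_le_cnstR (op (P.F.obj A.unop)) (b ^ Multiplicative.toAdd c)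
    (pow_mem hb _)
  have hb' : dm.div₀ (op (P.F.obj A.unop)) (b ^ Multiplicative.toAdd c) =
      Algebra.GrothendieckGroup.of (P.d A.unop ^ Multiplicative.toAdd (c ^ k)) := by
    rw [map_pow, hbd, ← pow_mul, ← map_pow, toAdd_pow, smul_eq_mul]
  change EtaleTheta.gpMap _ (dm.div₀ (op (P.F.obj A.unop)) (b ^ Multiplicative.toAdd c)) ∈ _ at key
  rw [hb'] at key
  -- the `n k`-th power of the class of `ι((d^c)^{1/n})` is `[ι(d^{ck})]`
  have e : Algebra.GrothendieckGroup.of ((hM.weak.toRealification.comp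
      (Perfection.map (powersHom _ (P.d A.unop)))) (Perfection.mk c n)) ^ ((n * ⟨k, hk⟩ : ℕ+) : ℕ) =
      EtaleTheta.gpMap ((RealifiedDivisorMonoids.ofRlfZWeak dm hpf).toR (op (P.F.obj A.unop)))
        (Algebra.GrothendieckGroup.of (P.d A.unop ^ Multiplicative.toAdd (c ^ k))) := by
    rw [PNat.mul_coe, PNat.mk_coe, pow_mul]
    simp only [← map_pow]
    rw [Perfection.mk_pow_self]
    simp only [← map_pow]
    rw [EtaleTheta.gpMap_of]
    rfl
  exact (congrArg (· ∈ (RealifiedDivisorMonoids.ofRlfZWeak dm hpf).cnstR (op (P.F.obj A.unop))) e).mpr key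

/-! ### The realified coordinates and `Φ ∩ ℝ·Φ₀^cnst ⊆ ι(⟨d⟩^pf)` -/

/-- **The realified coordinate `κ_i^rlf : Φ₀(F A)^rlf → (ℤ_{≥0})^rlf`** over `κ_i^pf` (weak universal property of the
realification, [FrdI] Prop. 5.3). [cite: MochizukiFrdI2008, Prop. 5.3 p.103] -/
theorem exists_coordRlf (P : PowDiagonalBase dm D) (A : D) (i : P.I A) :
    ∃ χ : (hpf (op (P.F.obj A))).weak.Rlf →* PiNatRlfWeak.natWeak.Rlf,
      χ.comp (hpf (op (P.F.obj A))).weak.toRealification =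
        PiNatRlfWeak.natWeak.toRealification.comp (Perfection.map (P.κ A i)) :=
  (RlfUniversalWeak.existsUnique_map (hpf _).weak (hpf _).rlfCofinal PiNatRlfWeak.natWeak
    PiNatRlfWeak.natWeak.supports_rlf_R _).exists

/-- The realified coordinate on the image of `Φ₀^pf`. [cite: MochizukiFrdI2008, Prop. 5.3 p.103] -/
theorem coordRlf_apply (P : PowDiagonalBase dm D) {A : D} {i : P.I A} {χ : (hpf (op (P.F.obj A))).weak.Rlf →* PiNatRlfWeak.natWeak.Rlf}
    (hχ : χ.comp (hpf (op (P.F.obj A))).weak.toRealification =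
      PiNatRlfWeak.natWeak.toRealification.comp (Perfection.map (P.κ A i)))
    (a : Perfection (dm.Φ₀.obj (op (P.F.obj A)))) :
    χ ((hpf (op (P.F.obj A))).weak.toRealification a) = PiNatRlfWeak.natWeak.toRealification (Perfection.map (P.κ A i) a) := by
  have h := DFunLike.congr_fun hχ a
  rwa [MonoidHom.comp_apply, MonoidHom.comp_apply] at h

/-- **`Φ ∩ ℝ·Φ₀^cnst ⊆ ι(⟨d⟩^pf)`**: if `ι(a) ∈ Φ(A)` lies in the `ℝ`-span `ℝ·[d_A]`, then the coordinates of `a` follow the diagonal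
pattern, `κ_i = n_i · κ_{i₀}` — the span is killed by the `ℝ`-linear functionals `κ_i^rlf / (κ_{i₀}^rlf)^{n_i}` on `(Φ₀^rlf)^gp`,
which kill `[d_A]` (`κ_i(d_A) = n_i`, `κ_{i₀}(d_A) = 1`) and hence `Φ₀^cnst ⊆ ⟨[d_A]⟩` (`RealificationData.realSpan_le_ker`,
`IsPerfFactorialWeak.Rlf.map_realSMul`) — so `a ∈ ⟨d_A⟩^pf`. [cite: MochizukiEtTh2009, Def 3.6 p.77] -/
theorem mem_diagImage_of_mem_cnstR (P : PowDiagonalBase dm D) (A : Dᵒᵖ) {x : (RealifiedDivisorMonoids.ofRlfZWeak dm hpf).ΦR.obj (op (P.F.obj A.unop))}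
    (hx : x ∈ P.pfImage hpf A)
    (hc : Algebra.GrothendieckGroup.of x ∈ (RealifiedDivisorMonoids.ofRlfZWeak dm hpf).cnstR (op (P.F.obj A.unop))) :
    x ∈ P.diagImage hpf A := by
  obtain ⟨a, rfl⟩ := hx
  have hM := hpf (op (P.F.obj A.unop))
  -- the coordinates of `a` follow the diagonal pattern
  have hcoord : ∀ i : P.I A.unop, Perfection.map (P.κ A.unop i) a =
      Perfection.map (P.κ A.unop (P.i₀ A.unop)) a ^ Multiplicative.toAdd (P.κ A.unop i (P.d A.unop)) := by
    intro i
    set n : ℕ := Multiplicative.toAdd (P.κ A.unop i (P.d A.unop)) with hn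
    obtain ⟨χ, hχ⟩ := P.exists_coordRlf hpf A.unop i
    obtain ⟨χ₀, hχ₀⟩ := P.exists_coordRlf hpf A.unop (P.i₀ A.unop)
    -- the `ℝ`-linear functional `Dg := κ_i^rlf / (κ_{i₀}^rlf)^{n_i}` on `(Φ₀^rlf)^gp`
    let Dg : Algebra.GrothendieckGroup hM.weak.Rlf →* Algebra.GrothendieckGroup PiNatRlfWeak.natWeak.Rlf :=
      { toFun := fun ξ => MonGp.map χ ξ / MonGp.map χ₀ ξ ^ n
        map_one' := by rw [map_one, map_one, one_pow, div_one]
        map_mul' := fun ξ η => by rw [map_mul, map_mul, mul_pow, mul_div_mul_comm] }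
    have hDg : ∀ ξ, Dg ξ = MonGp.map χ ξ / MonGp.map χ₀ ξ ^ n := fun _ => rfl
    -- the pattern of `d` at `i`: `κ_i(d)^{1/1} = (κ_{i₀}(d)^{1/1})^{n_i}` in `(ℤ_{≥0})^pf`
    have hdn : Perfection.mk (P.κ A.unop i (P.d A.unop)) 1 =
        Perfection.mk (P.κ A.unop (P.i₀ A.unop) (P.d A.unop)) 1 ^ n := by
      rw [Perfection.mk_pow, P.κ_d₀, ← ofAdd_nsmul, smul_eq_mul, mul_one, hn, ofAdd_toAdd]
    -- `Dg` kills the image of `d`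
    have hDd : Dg (Algebra.GrothendieckGroup.of (hM.weak.toRealification (Perfection.of _ (P.d A.unop)))) = 1 := by
      rw [hDg, MonGp.map_of, MonGp.map_of, P.coordRlf_apply hpf hχ, P.coordRlf_apply hpf hχ₀, Perfection.of_apply,
        Perfection.map_mk, Perfection.map_mk, hdn, map_pow, map_pow, div_self']
    have hle : (RealifiedDivisorMonoids.ofRlfZWeak dm hpf).cnstR (op (P.F.obj A.unop)) ≤ Dg.ker := by
      rw [RealifiedDivisorMonoids.ofRlfZWeak_cnstR]
      apply RealificationData.realSpan_le_ker
      · -- the kernel is stable under the scalars `r • (−)` (`ℝ`-linearity of `κ^rlf`; `r • (−)` is a homomorphism)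
        change ∀ (r : ℝ) (ξ : Algebra.GrothendieckGroup hM.weak.Rlf), Dg ξ = 1 →
          Dg (IsPerfFactorialWeak.Rlf.realSMul hM.weak r ξ) = 1
        intro r ξ hξ
        rw [hDg, div_eq_one] at hξ
        rw [hDg, IsPerfFactorialWeak.Rlf.map_realSMul, IsPerfFactorialWeak.Rlf.map_realSMul, hξ, map_pow, div_self']
      · -- `Dg` kills `ι^gp(Φ₀^cnst)`: `Φ₀^cnst ⊆ ⟨[d]⟩` and `ι^gp([d]^k) = [ι(d)]^k`
        let ιgp : Algebra.GrothendieckGroup (dm.Φ₀.obj (op (P.F.obj A.unop))) →* Algebra.GrothendieckGroup hM.weak.Rlf :=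
          (RealifiedDivisorMonoids.realDataWeak dm hpf).toRlfGp (P.F.obj A.unop)
        change ∀ c, c ∈ dm.cnstGp.carrier (P.F.obj A.unop) → (Dg.comp ιgp) c = 1
        intro c hc
        have hsub : (↑(dm.cnst (op (P.F.obj A.unop))) : Set (Algebra.GrothendieckGroup (dm.Φ₀.obj (op (P.F.obj A.unop))))) ⊆
            ↑(Dg.comp ιgp).ker := by
          rintro _ ⟨b, hb, rfl⟩
          obtain ⟨k, hk⟩ := Subgroup.mem_zpowers_iff.mp (P.div₀_mem_zpowers A.unop b hb)
          change Dg (ιgp (dm.div₀ _ b)) = 1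
          rw [← hk, show ιgp (Algebra.GrothendieckGroup.of (P.d A.unop) ^ k) = _ from P.toRlfGp_of_d_zpow hpf A.unop k,
            map_zpow, hDd, one_zpow]
        exact (Subgroup.closure_le _).mpr hsub hc
    have h1 : Dg (Algebra.GrothendieckGroup.of (hM.weak.toRealification a)) = 1 := hle hc
    rw [hDg, div_eq_one, MonGp.map_of, MonGp.map_of, ← map_pow] at h1
    haveI := IsPerfFactorialWeak.Rlf.isCancelMul PiNatRlfWeak.natWeak
    have h2 := Algebra.GrothendieckGroup.of_injective h1
    rw [P.coordRlf_apply hpf hχ, P.coordRlf_apply hpf hχ₀, ← map_pow] at h2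
    exact PfImageWeak.toRealification_injective _ h2
  obtain ⟨b, hb⟩ := P.mem_mrange_map_powersHom_of_forall_eq A.unop a hcoord
  exact ⟨b, congrArg hM.weak.toRealification hb⟩

/-- **`Φ(A) ∩ ℝ·Φ₀^cnst(F A) = ι(⟨d_A⟩^pf)`** ("`Φ^{bs-fld}(A)`"). [cite: MochizukiEtTh2009, Def 3.6 p.77] -/
theorem pfImage_inf_cnstR_eq (P : PowDiagonalBase dm D) (A : Dᵒᵖ) :
    P.pfImage hpf A ⊓ ((RealifiedDivisorMonoids.ofRlfZWeak dm hpf).cnstR (op (P.F.obj A.unop))).toSubmonoid.comap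
      Algebra.GrothendieckGroup.of = P.diagImage hpf A :=
  le_antisymm (fun _ hx => P.mem_diagImage_of_mem_cnstR hpf A hx.1 hx.2)
    fun _ hx => ⟨P.diagImage_le_pfImage hpf A hx, P.of_mem_cnstR_of_mem_diagImage hpf A hx⟩

/-! ### `Φ` as a subfunctor in monoids along `F` -/

/-- **`Φ ⊆ Φ^{ℝ-log} := Φ₀^ℝ|_D` as a subfunctor in monoids along `F`.** [cite: MochizukiEtTh2009, Def 3.6 p.76] -/
def Φsub (P : PowDiagonalBase dm D) : SubMonoidOn (P.F.op ⋙ (RealifiedDivisorMonoids.ofRlfZWeak dm hpf).ΦR) where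
  carrier A := P.pfImage hpf A
  map_mem := by
    rintro A B f _ ⟨a, rfl⟩
    exact ⟨Literature.AlgebraicGeometry.Frobenioids.Perfection.map (dm.Φ₀.map (P.F.map f.unop).op).hom a,
      (DFunLike.congr_fun (rlfMapWeak_comp_toRealification dm.Φ₀ hpf (P.F.map f.unop).op) a).symm⟩

/-- The carrier of `Φsub` at `A` is `Φ(A)`. [cite: MochizukiEtTh2009, Def 3.6 p.76] -/
@[simp] theorem Φsub_carrier (P : PowDiagonalBase dm D) (A : Dᵒᵖ) : (P.Φsub hpf).carrier A = P.pfImage hpf A := rfl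

/-- **The pull-backs of `Φ` are injective** (abc-iut-w6-d048's `rlfMapWeak_injective_of_reflects`).
[cite: MochizukiFrdI2008, Def. 1.1 (ii) p.19] -/
theorem Φsub_pull_injective (P : PowDiagonalBase dm D) {A B : Dᵒᵖ} (f : A ⟶ B) : Injective ((P.Φsub hpf).pull f) := by
  intro x y h
  apply Subtype.ext
  have h' := congrArg Subtype.val h
  exact rlfMapWeak_injective_of_reflects dm.Φ₀ hpf (P.F.map f.unop).op (P.hΦinj f.unop) (P.hΦrefl f.unop) h'

end PowDiagonalBase

section Engine

variable {D₀ : Type u₀} [Category.{v₀} D₀] {dm : DivisorMonoids.{u₀, v₀, 0} D₀}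
  (hpf : ∀ Y : D₀ᵒᵖ, IsPerfFactorialCof (dm.Φ₀.obj Y)) {D : Type u} [Category.{v} D] (P : PowDiagonalBase dm D)
  (hD : IsConnected D) (hD' : IsTotallyEpimorphic D) (hFSM : IsOfFSMType D) (R S : (Dᵒᵖ ⥤ CommMonCat.{0}) → Prop)

include hFSM in
/-- **Def. 3.6 (ii) data of monoid type `ℤ` over the weak Def. 3.6 (i) data `ofRlfZWeak dm hpf`, ALONG THE BASE FUNCTOR `P.F` of
diagonal base data** (`D` connected, totally epimorphic, of FSM-type): `Φ := im(Φ₀^pf → Φ₀^rlf)` objectwise along `F`; every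
condition PROVED — in particular (a) `Φ^{bs-fld}(A) = ι(⟨d_A⟩^pf)` monoprime (a PROPER submonoid of `Φ(A)` in rank `> 1`) and
(b) `div(ϖ) = ι(d_A)/1 ≠ 1`. [cite: MochizukiEtTh2009, Def 3.6 p.77] -/
def ofPowDiagonalBase : TemperedFrobenioid (RealifiedDivisorMonoids.ofRlfZWeak dm hpf) D (treeCatVocab D R S) where
  isConnected := hD
  isTotallyEpimorphic := hD'
  base := P.F
  Φ := P.Φsub hpf
  isGroupSaturated A := PfImageWeak.isGroupSaturated_mrange_toRealification (hpf (op (P.F.obj A.unop))).weak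
  isPerfFactorial A := PfImageWeak.isPerfFactorialCof_mrange_toRealification (hpf (op (P.F.obj A.unop)))
  isDivisorialOn := by
    rw [treeCatVocab_isDivisorialOn]
    refine ⟨⟨fun f => isCharInjective_of_injective_of_isSharp _ (P.Φsub_pull_injective hpf f.op)
      (PfImageWeak.isDivisorial_mrange_toRealification (hpf _)).isSharp, fun f hf => ?_⟩,
      fun A => PfImageWeak.isDivisorial_mrange_toRealification (hpf (op (P.F.obj A)))⟩
    exact (fun _ : IsIso f => PreFrobenioid.RatFrac.pull_bijective_of_isIso f) (hFSM.isIso_of_isFSM f hf)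
  isMonoprime_bsFld A :=
    IsMonoprime.of_mulEquiv (MulEquiv.submonoidCongr (P.pfImage_inf_cnstR_eq hpf A).symm) (P.isMonoprime_diagImage hpf A)
  exists_FΛ_div_ne A := by
    obtain ⟨b, hb, k, hk, hbd⟩ := P.exists_div₀_eq_pow A.unop
    refine ⟨b, hb, (hpf (op (P.F.obj A.unop))).weak.toRealification (Perfection.of _ (P.d A.unop ^ k)), ⟨_, rfl⟩, 1, one_mem _,
      P.toRealification_d_pow_ne_one hpf A.unop hk, ?_⟩
    · simp only [map_one, div_one]
      rw [RealifiedDivisorMonoids.ofRlfZWeak_divΛ_apply]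
      change EtaleTheta.gpMap _ (dm.div₀ (op (P.F.obj A.unop)) b) = _
      rw [hbd, map_pow, EtaleTheta.gpMap_of, ← map_pow, ← map_pow]
      rfl

/-- `Φ(A)` of the engine is `im(Φ₀(F A)^pf → Φ₀(F A)^rlf)`. [cite: MochizukiEtTh2009, Def 3.6 p.77] -/
@[simp] theorem ofPowDiagonalBase_Φ_carrier (A : Dᵒᵖ) :
    (ofPowDiagonalBase hpf P hD hD' hFSM R S).Φ.carrier A = P.pfImage hpf A := rfl

/-- **`Φ^{bs-fld}(A)` of the engine is the diagonal image `ι(⟨d_A⟩^pf)`** — Def. 3.6 (ii)(a) with content.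
[cite: MochizukiEtTh2009, Def 3.6 p.77] -/
theorem ofPowDiagonalBase_bsFld_carrier (A : Dᵒᵖ) :
    (ofPowDiagonalBase hpf P hD hD' hFSM R S).bsFld.carrier A = P.diagImage hpf A :=
  P.pfImage_inf_cnstR_eq hpf A

/-- **`Φ(A)` is perfect** (the image of the perfection `Φ₀(F A)^pf`; the `hP` slot of the §4 setting).
[cite: MochizukiEtTh2009, Def 4.1 p.86] -/
theorem ofPowDiagonalBase_isPerfect (A : Dᵒᵖ) : IsPerfect ((ofPowDiagonalBase hpf P hD hD' hFSM R S).Φ.carrier A) :=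
  IsPerfect.of_mulEquiv (MulEquiv.ofBijective _ (PfImageWeak.mrangeRestrict_toRealification_bijective (hpf _).weak))
    isPerfect_perfection

/-- **The engine's tempered Frobenioid IS a Frobenioid** ([FrdI] Thm. 5.2 (ii); abc-iut-L2-t3's `isFrobenioid_of_isOfFSMType`,
`hBinj` from the injectivity of the `B₀`-pull-backs). [cite: MochizukiFrdI2008, Thm. 5.2 (ii) p.100] -/
theorem isFrobenioid_ofPowDiagonalBase (hB₀inj : ∀ {Y Y' : D₀ᵒᵖ} (g : Y ⟶ Y'), Injective (dm.B₀.map g).hom) :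
    PreFrobenioid.IsFrobenioid (ofPowDiagonalBase hpf P hD hD' hFSM R S).toElem :=
  (ofPowDiagonalBase hpf P hD hD' hFSM R S).isFrobenioid_of_isOfFSMType
    (RealifiedDivisorMonoids.ofRlfZWeak_hBinj dm hpf hB₀inj) hFSM

end Engine

end TemperedFrobenioid

end Literature.AnabelianGeometry.EtaleTheta

end
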